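import Summits.HodgeConjecture.HodgeConjecture.Theorems.CyclicUnitaryPowersSpectralProjectors

/-!
# Block scalars `Σ_j c_j P_j` and the block product formula for determinants

Second shared eigenblock helper for the crux `PowersHodgeOfDeckCommutators` (stmt-HodgeConjecture-19545, route
`CyclicUnitaryPowers`, line `unitary-kunneth-fft` v5, lane 2 stubs D₂ `stub_deckUnitaryCommutatorGeneration` and
T `stub_unitaryTorusLemma`).  With the spectral projectors `P_j = specProj σ ζ p j` of
`CyclicUnitaryPowersSpectralProjectors`:

* `blockScalar σ ζ p c = Σ_{j<p} c j • P_j` — the endomorphism acting by the scalar `c j` on the `ζ^j`-eigenspace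
  (D₂'s `g_λ` with `c = (1, λ, …, λ, λ⁻¹, …, λ⁻¹)`; T's centre `Z` of `U⁰(ℂ)`): it commutes with `σ`
  (`blockScalar_comm`), acts by `c j` on `E_j` (`blockScalar_apply_of_mem_eigenspace`), is multiplicative in `c`
  (`blockScalar_mul`, `blockScalar_one`), preserves every `σ`-invariant bilinear form as soon as
  `c j * c (p - j) = 1` for `0 < j < p` and `c 0 = 1` (`blockScalar_isometry`), and has block determinants
  `det (blockScalar ∘ P_j + (1 - P_j)) = (c j) ^ finrank E_j` (`det_blockScalar_block`);
* `prod_block_eq` — an endomorphism `f` commuting with `σ` is the product of its commuting block factors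
  `f P_j + (1 - P_j)`, hence `det f = Π_{j<p} det (f P_j + (1 - P_j))` (`det_eq_prod_det_block`).
-/

noncomputable section

open Module
open scoped BigOperators

namespace Summit.HodgeConjecture.HodgeConjecture.Theorems.CyclicUnitaryPowersBlockScalars

open Summit.HodgeConjecture.HodgeConjecture.Theorems.CyclicUnitaryPowersSpectralProjectors

variable {K : Type*} [Field K] {W : Type*} [AddCommGroup W] [Module K W]
variable {σ : W →ₗ[K] W} {ζ : K} {p : ℕ}

/-- The block scalar `Σ_{j<p} c j • P_j`. [folklore] -/
def blockScalar (σ : W →ₗ[K] W) (ζ : K) (p : ℕ) (c : ℕ → K) : Module.End K W :=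
  ∑ j ∈ Finset.range p, c j • specProj σ ζ p j

/-- Unfolding lemma. [folklore] -/
theorem blockScalar_def (c : ℕ → K) :
    blockScalar σ ζ p c = ∑ j ∈ Finset.range p, c j • specProj σ ζ p j := rfl

/-- A block scalar commutes with `σ` (each `P_j` is a polynomial in `σ`). [folklore] -/
theorem blockScalar_comm (c : ℕ → K) : blockScalar σ ζ p c * σ = σ * blockScalar σ ζ p c := by
  rw [blockScalar_def, Finset.sum_mul, Finset.mul_sum]
  refine Finset.sum_congr rfl fun j _ => ?_
  rw [smul_mul_assoc, mul_smul_comm, commute_specProj (ζ := ζ) (p := p) σ rfl j]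

variable [CharZero K]

/-- A block scalar acts by `c j` on the `ζ^j`-eigenspace (`j < p`). [folklore] -/
theorem blockScalar_apply_of_mem_eigenspace (hζ : IsPrimitiveRoot ζ p) (hp : 0 < p) (c : ℕ → K) {j : ℕ}
    (hj : j < p) {x : W} (hx : x ∈ Module.End.eigenspace σ (ζ ^ j)) : blockScalar σ ζ p c x = c j • x := by
  rw [blockScalar_def, LinearMap.sum_apply]
  rw [Finset.sum_eq_single_of_mem j (Finset.mem_range.mpr hj)]
  · rw [LinearMap.smul_apply, specProj_apply_of_mem_eigenspace hζ hp j hx]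
  · intro k hk hkj
    rw [LinearMap.smul_apply, specProj_apply_of_mem_eigenspace_of_ne hζ hp (Finset.mem_range.mp hk) hj hkj hx,
      smul_zero]

/-- A block scalar on a spectral component: `g_c (P_j x) = c j • P_j x` (`j < p`). [folklore] -/
theorem blockScalar_specProj (hσ : σ ^ p = 1) (hζ : IsPrimitiveRoot ζ p) (hp : 0 < p) (c : ℕ → K) {j : ℕ}
    (hj : j < p) (x : W) : blockScalar σ ζ p c (specProj σ ζ p j x) = c j • specProj σ ζ p j x :=
  blockScalar_apply_of_mem_eigenspace hζ hp c hj (specProj_mem_eigenspace hσ hζ hp j x)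

/-- A block scalar with `c 0 = 1` fixes the `σ`-fixed vectors. [folklore] -/
theorem blockScalar_apply_of_fixed (hζ : IsPrimitiveRoot ζ p) (hp : 0 < p) (c : ℕ → K) (hc : c 0 = 1) {x : W}
    (hx : σ x = x) : blockScalar σ ζ p c x = x := by
  have hx' : x ∈ Module.End.eigenspace σ (ζ ^ 0) := by rw [Module.End.mem_eigenspace_iff, pow_zero, one_smul, hx]
  rw [blockScalar_apply_of_mem_eigenspace hζ hp c hp hx', hc, one_smul]

/-- `g_1 = 1`. [folklore] -/
theorem blockScalar_one (hζ : IsPrimitiveRoot ζ p) (hp : 0 < p) : blockScalar σ ζ p (fun _ => (1 : K)) = 1 := by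
  rw [blockScalar_def]
  simp_rw [one_smul]
  exact sum_specProj hζ hp

/-- Block scalars are multiplicative in `c`. [folklore] -/
theorem blockScalar_mul (hσ : σ ^ p = 1) (hζ : IsPrimitiveRoot ζ p) (hp : 0 < p) (c c' : ℕ → K) :
    blockScalar σ ζ p c * blockScalar σ ζ p c' = blockScalar σ ζ p (fun j => c j * c' j) := by
  ext x
  rw [Module.End.mul_apply]
  conv_lhs => rw [← sum_specProj_apply (σ := σ) hζ hp x]
  conv_rhs => rw [← sum_specProj_apply (σ := σ) hζ hp x]
  rw [map_sum, map_sum, map_sum]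
  refine Finset.sum_congr rfl fun k hk => ?_
  have hk' := Finset.mem_range.mp hk
  rw [blockScalar_specProj hσ hζ hp c' hk', map_smul, blockScalar_specProj hσ hζ hp c hk',
    blockScalar_specProj hσ hζ hp _ hk', smul_smul, mul_comm (c' k)]

/-- **A block scalar preserves every `σ`-invariant bilinear form** when `c j * c (p - j) = 1` for `0 < j < p` and
`c 0 * c 0 = 1`. [folklore] -/
theorem blockScalar_isometry (hσ : σ ^ p = 1) (hζ : IsPrimitiveRoot ζ p) (hp : 0 < p) {B : LinearMap.BilinForm K W}
    (hB : ∀ x y, B (σ x) (σ y) = B x y) (c : ℕ → K) (hc0 : c 0 * c 0 = 1)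
    (hc : ∀ j, 0 < j → j < p → c j * c (p - j) = 1) (x y : W) :
    B (blockScalar σ ζ p c x) (blockScalar σ ζ p c y) = B x y := by
  conv_lhs => rw [← sum_specProj_apply (σ := σ) hζ hp x, ← sum_specProj_apply (σ := σ) hζ hp y]
  conv_rhs => rw [← sum_specProj_apply (σ := σ) hζ hp x, ← sum_specProj_apply (σ := σ) hζ hp y]
  rw [map_sum, map_sum]
  simp only [map_sum, LinearMap.sum_apply]
  refine Finset.sum_congr rfl fun j hj => Finset.sum_congr rfl fun k hk => ?_
  have hj' := Finset.mem_range.mp hj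
  have hk' := Finset.mem_range.mp hk
  rw [blockScalar_specProj hσ hζ hp c hj', blockScalar_specProj hσ hζ hp c hk']
  simp only [map_smul, LinearMap.smul_apply, smul_eq_mul]
  by_cases hdvd : p ∣ j + k
  · -- then `c j * c k = 1`
    have hck : c j * c k = 1 := by
      rcases Nat.eq_zero_or_pos j with rfl | hjpos
      · have hk0 : k = 0 := Nat.eq_zero_of_dvd_of_lt (by simpa using hdvd) hk'
        subst hk0; exact hc0
      · have hjk : j + k = p := by
          obtain ⟨m, hm⟩ := hdvd
          rcases Nat.eq_zero_or_pos m with rfl | hmpos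
          · omega
          · have hlt : p * m < p * 2 := by rw [← hm]; omega
            have hm2 : m < 2 := Nat.lt_of_mul_lt_mul_left hlt
            have hm1 : m = 1 := by omega
            rw [hm, hm1, mul_one]
        have hkeq : k = p - j := by omega
        rw [hkeq]; exact hc j hjpos hj'
    calc c j * (c k * B (specProj σ ζ p k x) (specProj σ ζ p j y))
        = (c j * c k) * B (specProj σ ζ p k x) (specProj σ ζ p j y) := by ring
      _ = B (specProj σ ζ p k x) (specProj σ ζ p j y) := by rw [hck, one_mul]
  · have hdvd' : ¬ p ∣ k + j := fun h => hdvd (by rwa [add_comm] at h)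
    rw [apply_specProj_specProj_eq_zero hσ hζ hp hB hdvd' x y, mul_zero, mul_zero]

/-! ### Block determinants of block scalars -/

variable [FiniteDimensional K W]

/-- **`det (g_c ∘ P_j + (1 - P_j)) = (c j) ^ finrank E_j`** (`j < p`, `E_j` the `ζ^j`-eigenspace = `range P_j`).
[folklore] -/
theorem det_blockScalar_block (hσ : σ ^ p = 1) (hζ : IsPrimitiveRoot ζ p) (hp : 0 < p) (c : ℕ → K) {j : ℕ}
    (hj : j < p) :
    LinearMap.det (blockScalar σ ζ p c ∘ₗ specProj σ ζ p j + (1 - specProj σ ζ p j)) =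
      c j ^ Module.finrank K (LinearMap.range (specProj σ ζ p j)) := by
  rw [det_comp_specProj_add hσ hζ hp (blockScalar σ ζ p c) (blockScalar_comm c) j]
  have hres : (blockScalar σ ζ p c).restrict
      (mapsTo_range_of_commute (commute_specProj (ζ := ζ) (p := p) (blockScalar σ ζ p c)
        (blockScalar_comm c) j)) = c j • LinearMap.id := by
    ext ⟨x, hx⟩
    rw [LinearMap.coe_restrict_apply, LinearMap.smul_apply, LinearMap.id_apply, Submodule.coe_smul]
    rw [range_specProj hσ hζ hp j] at hx
    exact blockScalar_apply_of_mem_eigenspace hζ hp c hj hx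
  rw [hres, LinearMap.det_smul, LinearMap.det_id, mul_one]

/-! ### The block product formula -/

omit [CharZero K] [FiniteDimensional K W] in
/-- Product of commuting block factors over pairwise-orthogonal idempotents:
`Π_{j ∈ l} (f P_j + (1 - P_j)) = f (Σ_{j∈l} P_j) + (1 - Σ_{j ∈ l} P_j)` for a duplicate-free list `l`. [folklore] -/
theorem prod_block_factor (f : Module.End K W) (P : ℕ → Module.End K W) (l : List ℕ) (hl : l.Nodup)
    (hcomm : ∀ j, f * P j = P j * f) (hidem : ∀ j ∈ l, P j * P j = P j)
    (horth : ∀ j ∈ l, ∀ k ∈ l, j ≠ k → P j * P k = 0) :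
    (l.map fun j => f * P j + (1 - P j)).prod = f * (l.map P).sum + (1 - (l.map P).sum) := by
  induction l with
  | nil => simp
  | cons a l ih =>
    have ha : a ∉ l := (List.nodup_cons.mp hl).1
    rw [List.map_cons, List.prod_cons, List.map_cons, List.sum_cons,
      ih (List.nodup_cons.mp hl).2 (fun j hj => hidem j (List.mem_cons_of_mem a hj))
        (fun j hj k hk => horth j (List.mem_cons_of_mem a hj) k (List.mem_cons_of_mem a hk))]
    set S := (l.map P).sum with hS
    have hPS : P a * S = 0 := by
      rw [hS, ← List.sum_map_mul_left]
      exact List.sum_eq_zero (by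
        intro x hx
        obtain ⟨j, hj, rfl⟩ := List.mem_map.mp hx
        exact horth a (List.mem_cons_self) j (List.mem_cons_of_mem a hj) (fun h => ha (h ▸ hj)))
    have hPf : P a * f = f * P a := (hcomm a).symm
    have h1 : f * P a * (f * S) = 0 := by
      rw [mul_assoc f (P a), ← mul_assoc (P a) f S, hPf, mul_assoc f (P a) S, hPS, mul_zero, mul_zero]
    have h2 : f * P a * (1 - S) = f * P a := by rw [mul_sub, mul_one, mul_assoc, hPS, mul_zero, sub_zero]
    have h3 : (1 - P a) * (f * S) = f * S := by
      rw [sub_mul, one_mul, ← mul_assoc, hPf, mul_assoc, hPS, mul_zero, sub_zero]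
    have h4 : (1 - P a) * (1 - S) = 1 - (P a + S) := by
      rw [mul_sub, sub_mul, sub_mul, one_mul, mul_one, one_mul, hPS, sub_zero]; abel
    rw [mul_add, add_mul, add_mul, h1, h2, h3, h4, zero_add, mul_add]
    abel

omit [CharZero K] [FiniteDimensional K W] in
/-- `Σ` over `List.range` is `Σ` over `Finset.range`. [folklore] -/
theorem list_range_map_sum {M : Type*} [AddCommMonoid M] (g : ℕ → M) (n : ℕ) :
    ((List.range n).map g).sum = ∑ j ∈ Finset.range n, g j := by
  rw [Finset.sum_eq_multiset_sum, Finset.range_val, ← Multiset.coe_range, Multiset.map_coe, Multiset.sum_coe]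

omit [CharZero K] [FiniteDimensional K W] in
/-- `Π` over `List.range` is `Π` over `Finset.range` (commutative target). [folklore] -/
theorem list_range_map_prod {M : Type*} [CommMonoid M] (g : ℕ → M) (n : ℕ) :
    ((List.range n).map g).prod = ∏ j ∈ Finset.range n, g j := by
  rw [Finset.prod_eq_multiset_prod, Finset.range_val, ← Multiset.coe_range, Multiset.map_coe, Multiset.prod_coe]

omit [FiniteDimensional K W] in
/-- **Block product formula**: an endomorphism commuting with `σ` is the (ordered) product over `j < p` of its
block factors `f P_j + (1 - P_j)`. [folklore] -/
theorem prod_block_eq (hσ : σ ^ p = 1) (hζ : IsPrimitiveRoot ζ p) (hp : 0 < p) (f : Module.End K W)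
    (hf : f * σ = σ * f) :
    ((List.range p).map fun j => f * specProj σ ζ p j + (1 - specProj σ ζ p j)).prod = f := by
  rw [prod_block_factor f (fun j => specProj σ ζ p j) (List.range p) List.nodup_range
    (fun j => commute_specProj f hf j) (fun j _ => (isIdempotentElem_specProj hσ hζ hp j).eq)
    (fun j hj k hk hjk => by
      rw [Module.End.mul_eq_comp, specProj_comp_specProj hσ hζ hp (List.mem_range.mp hj) (List.mem_range.mp hk),
        if_neg hjk]),
    list_range_map_sum, sum_specProj hζ hp, mul_one, sub_self, add_zero]

omit [FiniteDimensional K W] in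
/-- **`det f = Π_{j<p} det (f P_j + (1 - P_j))`** for `f` commuting with `σ`. [folklore] -/
theorem det_eq_prod_det_block (hσ : σ ^ p = 1) (hζ : IsPrimitiveRoot ζ p) (hp : 0 < p) (f : Module.End K W)
    (hf : f * σ = σ * f) :
    LinearMap.det f = ∏ j ∈ Finset.range p, LinearMap.det (f * specProj σ ζ p j + (1 - specProj σ ζ p j)) := by
  conv_lhs => rw [← prod_block_eq hσ hζ hp f hf]
  rw [map_list_prod, List.map_map, ← list_range_map_prod]
  rfl

end Summit.HodgeConjecture.HodgeConjecture.Theorems.CyclicUnitaryPowersBlockScalars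

end
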